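/-
Copyright (c) 2026 the pub-hodgecm-mathlib formalisation cell (harness21).  Prover seat hodgecm-mathlib-LH4-p12 (g8), req620 Track A «(D-RAM) FOUR-FRAME» squad
((β₂) road (R-36), β₂-BOARD v2 §4 (OFF) sockets `hDeep` ∕ `hL0` of the ED. 4 dispatch: ★ p862869's cell fold at shell level `ℓ₀`, and at the odd-`d` level-0 strip —
second hand to the (OFF) lead LH7-p09 (g2), on his «= (2)+(3) yours» 2026-09-04T23:24:23Z), 2026-09-04.
-/
import Summits.HodgeConjecture.HodgeConjecture.Theorems.F0P3cDyRamConeCellPresentation        -- ★ p862869 (LH7-p09 (g2)): the JUNCTION `exists_presentation_of_mem_levelSetDep` and the level-0 fold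
import Summits.HodgeConjecture.HodgeConjecture.Theorems.F0P3cDyRamDeepConeCellOffShellLevel     -- ★ p863123 (LH7-p09 (g2)): `not_latticeNearTransvShell_of_deep_level`, `not_latticeNearTransvShell_one_of_antidiagonal`
import HarnessLib

/-!
# Crux `H413`, line LH4 «(D-RAM) FOUR-FRAME» — the (β₂) road (R-36) «PURE-CELL LEDGER», (L-Σ-3B) «OFF-ROW ZERO» (OFF.letter.v2): THE CELL FOLDS AT SHELL LEVEL `ℓ₀` —
# «A CONE CELL `ℓ₀ + 1` DIGITS DEEP HAS NO VERTEX ON ANY LEVEL-`ℓ₀` SHELL» and «AT ODD `d` THE LEVEL-0 ANTI-DIAGONAL HAS NO VERTEX ON ANY LEVEL-1 SHELL»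

Cell `hodgecm-mathlib` (D-0151), FLOOR 0, crux item H413 = `stmt-HodgeConjecture-24833`, route of record `HCCMUnconditional`; squad F0∕P3c∕LH4; lane
`--supports stmt-HodgeConjecture-24833 --as helper` (count-neutral; pays NO tier-0 row).  THEOREMS ONLY (no `def`, no instance, no notation, no `sorry`, default heartbeats);
★-only imports; states NO law; (β₂) stays a HYPOTHESIS.  DATUM-FREE over ★ p862869's frame (★ (C1) block-frame binders, one literal, general block `(H₂, h_W)`; `hϖmax`,
`|lam| = 1`; cone cell `(j, b)`, `lam ∈ 𝒪_j`).

WHY (β₂ WORD #18 PARITY RULING; (OFF) dispatch ED. 4 `…OffRowOfPiecesParity.cellDiff_offRow_eq_zero_of_pieces₄`, sockets `hDeep`, `hL0`; LH7-p09 (g2) 23:24:23Z «= (2)+(3) yours»).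
★ p862869 `levelSetDep_inter_shell_eq_empty_of_deep` folds ★ p862651's per-vertex «deep ⇒ level ≥ 1» into the emptiness of the shell-cut subset of a cone cell — at shell level `0`,
i.e. for EVEN `d`.  ★ p863123 (LH7-p09) carries the per-vertex statements at every level: `not_latticeNearTransvShell_of_deep_level` (deep letters `2b + ℓ₀ + 1`, `b + ℓ₀ + 1` ⇒ off
the level-`ℓ₀` shell) and, for the odd-`d` strip below the level-1 shell, `not_latticeNearTransvShell_one_of_antidiagonal` (the anti-diagonal `|μ − ρμ| = |cc(α − ρα)|·|ϖE|^b`,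
`|cc| < |ϖE|^b`, `|μ| ≤ |ϖE|^{2b+1}` sits on level EXACTLY `0`).  THIS FILE is the two CELL FOLDS over the junction ★ `exists_presentation_of_mem_levelSetDep`:
* `levelSetDep_inter_shell_eq_empty_of_deep_level` — region `2b + ℓ₀ < m`, `j + b + ℓ₀ < jl` (`b ≤ j`): the (OFF) socket `hDeep` at BOTH parities (`ℓ₀ := d % 2`);
* `levelSetDep_inter_shell_eq_empty_of_antidiagonal_one` — region `2b < m`, `j + b = jl`, `b < j`, shell level `1`: the (OFF) socket `hL0` (odd `d`).
Both for every precision `m` and every extra predicate `P` (the two labels of the letter), so each pays its socket twice + `finsum_mem_empty`.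
HONEST LABEL.  Count-neutral lattice bookkeeping; nothing printed is asserted; no census law is stated; `HC_CM` is proved only modulo the 7 printed citations (2 remaining named
inputs: hLiu418 = `stmt-HodgeConjecture-24832`, h413 = `stmt-HodgeConjecture-24833`) until rung 0 closes.
## References
* [Kottwitz1986BaseChangeUnits] R. E. Kottwitz, *Base change for unit elements of Hecke algebras*, Compositio Math. 60 (1986): §1 pp. 240–241, §3.
* [Jacobowitz1962] R. Jacobowitz, *Hermitian forms over local fields*, Amer. J. Math. 84 (1962): §4 (duals, gluing).
* [Rogawski1990] J. D. Rogawski, *Automorphic Representations of Unitary Groups in Three Variables*, Ann. of Math. Stud. 123 (1990): §4.9 Prop. 4.9.1 (b) p. 55.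
* [Serre1979] J.-P. Serre, *Local Fields*, GTM 67 (1979): Ch. III §6 Prop. 12.
-/

set_option autoImplicit false

noncomputable section

namespace Summit.HodgeConjecture.HodgeConjecture.Cruxes.H413.F0P3cDyRamConeCellPresentationLevel

open scoped Valued WithZero Matrix MatrixGroups
open WithZero
open Literature.NumberTheory.Automorphic Literature.NumberTheory.Automorphic.HermitianLattice Literature.NumberTheory.Automorphic.UnitaryLatticeTree
open Literature.NumberTheory.Rogawski1990
open Summit.HodgeConjecture.HodgeConjecture.Cruxes.H413.F0P3cDyRamToricCensusDefs
open Summit.HodgeConjecture.HodgeConjecture.Cruxes.H413.F0P3cDyRamFourFrameCensusDefs (LatticeInLevel LatticeNearTransvShell)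
open Summit.HodgeConjecture.HodgeConjecture.Cruxes.H413.F0P3cDyRamBoundaryCellLetterCardTwo (v_map_lt_one_iff_of_le_iff)
open Summit.HodgeConjecture.HodgeConjecture.Cruxes.H413.F0P3cDyRamConeCellPresentation (exists_presentation_of_mem_levelSetDep)
open Summit.HodgeConjecture.HodgeConjecture.Cruxes.H413.F0P3cDyRamDeepConeCellOffShellLevel (not_latticeNearTransvShell_of_deep_level not_latticeNearTransvShell_one_of_antidiagonal)

variable {E M : Type} [Field E] [Valued E ℤᵐ⁰] [Field M] [Valued M ℤᵐ⁰] {ρ Θ : M →+* M} {α : M}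

/-- **FOLD — «A CONE CELL `ℓ₀ + 1` DIGITS DEEP HAS NO VERTEX ON ANY LEVEL-`ℓ₀` SHELL».**  ★ p862869 `levelSetDep_inter_shell_eq_empty_of_deep` with the shell level `0 ↦ ℓ₀`:
frame = ★ (C1) block-frame binders (one literal, general block `(H₂, h_W)`), `hϖmax`, `|lam| = 1`; cone cell `(j, b)` with `1 ≤ b ≤ j`, `lam ∈ 𝒪_j`; the literal's
`hum : |u₀₀ − 1| ≤ |ϖ^{m′}|` with `ℓ₀ + 1 ≤ m′`; DEEP letters `|μ| ≤ |ϖE|^{2b+ℓ₀+1}` (`2b + ℓ₀ < m`) and `|μ − ρμ| ≤ |ϖE^j(α − ρα)|·|ϖE|^{b+ℓ₀+1}` (`j + b + ℓ₀ < jl`).  THEN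
for every `m` and every `P` the shell-cut subset `levelSetDep(j, b; μ) ∩ {Λ ∣ ∃ B L₃, … ∧ LatticeNearTransvShell ϖ ℓ₀ m (Γ − 1) L₃ ∧ P L₃}` is EMPTY (junction ★
`exists_presentation_of_mem_levelSetDep` + ★ `not_latticeNearTransvShell_of_deep_level`).  Pays the (OFF) ED. 4 socket `hDeep` at `ℓ₀ = d % 2`, both parities.
[cite: Kottwitz1986BaseChangeUnits, §3] [cite: Jacobowitz1962, §4] [cite: Rogawski1990, §4.9 Prop. 4.9.1 (b) p. 55] -/
theorem levelSetDep_inter_shell_eq_empty_of_deep_level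
    (σ : E →+* E) (hσ : ∀ a, σ (σ a) = a) (hvσ : ∀ a, Valued.v (σ a) = Valued.v a) {ϖ : E} (hϖ : Valued.v ϖ = exp (-1 : ℤ))
    {H₂ : Matrix (Fin 2) (Fin 2) E} (hH₂ : IsUnit H₂.det) (hH₂σ : (H₂.map σ)ᵀ = H₂) {hW : E} (hhW : Valued.v hW = 1)
    (jE : E →+* M) (hρρ : ∀ x, ρ (ρ x) = x) (hvρ : ∀ x, Valued.v (ρ x) = Valued.v x) (hα : ρ α ≠ α) (hα1 : Valued.v α ≤ 1)
    (hint : ∀ z : M, Valued.v z ≤ 1 → Valued.v ((z - ρ z) / (α - ρ α)) ≤ 1)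
    (hΘΘ : ∀ x, Θ (Θ x) = x) (hΘρ : ∀ x, Θ (ρ x) = ρ (Θ x)) (hvΘ : ∀ x, Valued.v (Θ x) = Valued.v x)
    (hjv : ∀ c, Valued.v (jE c) ≤ 1 ↔ Valued.v c ≤ 1) (hjfix : ∀ z, ρ z = z ↔ ∃ c, jE c = z)
    (hjpow : ∀ (t : E) (n : ℤ), Valued.v (jE t) = Valued.v (jE ϖ) ^ n ↔ Valued.v t = Valued.v ϖ ^ n)
    (hϖmax : ∀ t : M, ρ t = t → Valued.v t < 1 → Valued.v t ≤ Valued.v (jE ϖ))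
    (φ : (Fin 2 → E) →+ M) (hφs : ∀ (c : E) (x : Fin 2 → E), φ (c • x) = jE c * φ x) (hφi : Function.Injective φ) (hφo : Function.Surjective φ)
    {γ₂ : GL (Fin 2) E} {lam h : M} (hφγ : ∀ x, φ ((γ₂ : Matrix (Fin 2) (Fin 2) E).mulVec x) = lam * φ x) (hlam : Valued.v lam = 1)
    (hΘh : Θ h = h) (hh : h ≠ 0) (hform : ∀ x y, jE (pairing σ H₂ x y) = h * Θ (φ x) * φ y + ρ (h * Θ (φ x) * φ y))
    (u : GL (Fin 1) E) {m' : ℕ} (ℓ₀ : ℕ) (hm1 : ℓ₀ + 1 ≤ m') (hum : Valued.v ((u : Matrix (Fin 1) (Fin 1) E) 0 0 - 1) ≤ Valued.v (ϖ ^ m'))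
    {b j : ℕ} (hb1 : 1 ≤ b) (hbj : b ≤ j) (hlamj : IsOrd ρ α (jE ϖ ^ j) lam)
    (hμ : Valued.v (lam - jE ((u : Matrix (Fin 1) (Fin 1) E) 0 0)) ≤ Valued.v (jE ϖ) ^ (2 * b + (ℓ₀ + 1)))
    (hanti : Valued.v ((lam - jE ((u : Matrix (Fin 1) (Fin 1) E) 0 0)) - ρ (lam - jE ((u : Matrix (Fin 1) (Fin 1) E) 0 0))) ≤
      Valued.v (jE ϖ ^ j * (α - ρ α)) * Valued.v (jE ϖ) ^ (b + (ℓ₀ + 1)))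
    (m : ℕ) (P : Submodule 𝒪[E] (Fin 3 → E) → Prop) :
    levelSetDep ρ Θ α (jE ϖ) h j b (lam - jE ((u : Matrix (Fin 1) (Fin 1) E) 0 0)) ∩
        {Λ | ∃ B : Submodule 𝒪[E] (Fin 2 → E), B.toAddSubgroup.map φ = Λ ∧
          ∃ L₃ : Submodule 𝒪[E] (Fin 3 → E), IsSelfDualLattice σ ϖ (!![H₂ 0 0, 0, H₂ 0 1; 0, hW, 0; H₂ 1 0, 0, H₂ 1 1] : Matrix (Fin 3) (Fin 3) E) L₃ ∧
            L₃ ⊓ LinearMap.ker ((LinearMap.proj (1 : Fin 3) : (Fin 3 → E) →ₗ[E] E).restrictScalars 𝒪[E]) =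
              B.map ((Matrix.toLin' (!![1, 0; 0, 0; 0, 1] : Matrix (Fin 3) (Fin 2) E)).restrictScalars 𝒪[E]) ∧
            (∀ c : E, (Pi.single 1 c : Fin 3 → E) ∈ L₃ ↔ Valued.v c ≤ Valued.v ϖ ^ b) ∧
            (LatticeNearTransvShell ϖ ℓ₀ m ((((endoGL (γ₂, u) : GL (Fin 3) E) : Matrix (Fin 3) (Fin 3) E) - 1)) L₃ ∧ P L₃)} = ∅ := by
  have hvϖ0 : Valued.v ϖ ≠ 0 := by rw [hϖ]; exact exp_ne_zero
  have hϖ0 : ϖ ≠ 0 := fun h0 => hvϖ0 (by rw [h0, map_zero])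
  have hϖlt : Valued.v ϖ < 1 := by rw [hϖ, ← exp_zero, exp_lt_exp]; norm_num
  have hjϖ0 : jE ϖ ≠ 0 := (map_ne_zero jE).2 hϖ0
  have hjϖle : Valued.v (jE ϖ) ≤ 1 := ((v_map_lt_one_iff_of_le_iff jE hjv ϖ).2 hϖlt).le
  have hcb : Valued.v (jE ϖ ^ j) ≤ Valued.v (jE ϖ) ^ b := by
    rw [Valuation.map_pow]; exact pow_le_pow_right_of_le_one' hjϖle hbj
  refine Set.subset_empty_iff.1 fun Λ hΛ => ?_
  obtain ⟨hΛ, B, hBΛ, L₃, hL, hLB, htube, hshell, -⟩ := hΛ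
  obtain ⟨x₀, w₀, g₀, hx₀, hΛx, hyO, -, hylev, hw₀Y, hpr, hg₀, hg₀1, hprg⟩ :=
    exists_presentation_of_mem_levelSetDep σ hσ hvσ hϖ hH₂ hH₂σ hhW jE hρρ hvρ hα hα1 hint hΘΘ hΘρ hvΘ hjv hjfix hjpow hϖmax φ hφs hφi hφo hφγ hlam hΘh hh hform
      ((u : Matrix (Fin 1) (Fin 1) E) 0 0) hb1 hlamj hΛ hBΛ hL hLB htube
  have hY0 : dualGen ρ Θ α (jE ϖ ^ j) h x₀ ≠ 0 := fun h0 => by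
    rw [h0, Valuation.map_zero] at hylev
    exact pow_ne_zero b ((Valuation.ne_zero_iff _).2 hjϖ0) hylev.symm
  exact not_latticeNearTransvShell_of_deep_level hvρ hα hα1 hϖ jE hjv hjfix φ hφs hφi hφγ htube hpr hLB.symm hg₀ hg₀1 hprg hBΛ hx₀ hΛx hw₀Y hyO hylev hcb
    u ℓ₀ hm1 hum hμ hanti m hshell

/-- **FOLD — «AT ODD `d` THE LEVEL-0 ANTI-DIAGONAL HAS NO VERTEX ON ANY LEVEL-1 SHELL».**  Same frame (no `hum` needed); cone cell `(j, b)` with `1 ≤ b < j`, `lam ∈ 𝒪_j`;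
ANTI-DIAGONAL letters `|μ| ≤ |ϖE|^{2b+1}` (`2b < m`) and `|μ − ρμ| = |ϖE^j(α − ρα)|·|ϖE|^b` EXACTLY (`j + b = jl`).  THEN for every `m` and every `P` the subset of
`levelSetDep(j, b; μ)` cut by `LatticeNearTransvShell ϖ 1 m (Γ − 1) L₃ ∧ P L₃` is EMPTY (junction + ★ `not_latticeNearTransvShell_one_of_antidiagonal`: such vertices sit on
level EXACTLY `0`).  Pays the (OFF) ED. 4 socket `hL0` (the strip `d % 2 = 1`, `2b + 1 < m`, `j + b = jl`).
[cite: Kottwitz1986BaseChangeUnits, §3] [cite: Jacobowitz1962, §4] [cite: Rogawski1990, §4.9 Prop. 4.9.1 (b) p. 55] -/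
theorem levelSetDep_inter_shell_eq_empty_of_antidiagonal_one
    (σ : E →+* E) (hσ : ∀ a, σ (σ a) = a) (hvσ : ∀ a, Valued.v (σ a) = Valued.v a) {ϖ : E} (hϖ : Valued.v ϖ = exp (-1 : ℤ))
    {H₂ : Matrix (Fin 2) (Fin 2) E} (hH₂ : IsUnit H₂.det) (hH₂σ : (H₂.map σ)ᵀ = H₂) {hW : E} (hhW : Valued.v hW = 1)
    (jE : E →+* M) (hρρ : ∀ x, ρ (ρ x) = x) (hvρ : ∀ x, Valued.v (ρ x) = Valued.v x) (hα : ρ α ≠ α) (hα1 : Valued.v α ≤ 1)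
    (hint : ∀ z : M, Valued.v z ≤ 1 → Valued.v ((z - ρ z) / (α - ρ α)) ≤ 1)
    (hΘΘ : ∀ x, Θ (Θ x) = x) (hΘρ : ∀ x, Θ (ρ x) = ρ (Θ x)) (hvΘ : ∀ x, Valued.v (Θ x) = Valued.v x)
    (hjv : ∀ c, Valued.v (jE c) ≤ 1 ↔ Valued.v c ≤ 1) (hjfix : ∀ z, ρ z = z ↔ ∃ c, jE c = z)
    (hjpow : ∀ (t : E) (n : ℤ), Valued.v (jE t) = Valued.v (jE ϖ) ^ n ↔ Valued.v t = Valued.v ϖ ^ n)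
    (hϖmax : ∀ t : M, ρ t = t → Valued.v t < 1 → Valued.v t ≤ Valued.v (jE ϖ))
    (φ : (Fin 2 → E) →+ M) (hφs : ∀ (c : E) (x : Fin 2 → E), φ (c • x) = jE c * φ x) (hφi : Function.Injective φ) (hφo : Function.Surjective φ)
    {γ₂ : GL (Fin 2) E} {lam h : M} (hφγ : ∀ x, φ ((γ₂ : Matrix (Fin 2) (Fin 2) E).mulVec x) = lam * φ x) (hlam : Valued.v lam = 1)
    (hΘh : Θ h = h) (hh : h ≠ 0) (hform : ∀ x y, jE (pairing σ H₂ x y) = h * Θ (φ x) * φ y + ρ (h * Θ (φ x) * φ y))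
    (u : GL (Fin 1) E)
    {b j : ℕ} (hb1 : 1 ≤ b) (hbj : b < j) (hlamj : IsOrd ρ α (jE ϖ ^ j) lam)
    (hμ : Valued.v (lam - jE ((u : Matrix (Fin 1) (Fin 1) E) 0 0)) ≤ Valued.v (jE ϖ) ^ (2 * b + 1))
    (hanti : Valued.v ((lam - jE ((u : Matrix (Fin 1) (Fin 1) E) 0 0)) - ρ (lam - jE ((u : Matrix (Fin 1) (Fin 1) E) 0 0))) =
      Valued.v (jE ϖ ^ j * (α - ρ α)) * Valued.v (jE ϖ) ^ b)
    (m : ℕ) (P : Submodule 𝒪[E] (Fin 3 → E) → Prop) :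
    levelSetDep ρ Θ α (jE ϖ) h j b (lam - jE ((u : Matrix (Fin 1) (Fin 1) E) 0 0)) ∩
        {Λ | ∃ B : Submodule 𝒪[E] (Fin 2 → E), B.toAddSubgroup.map φ = Λ ∧
          ∃ L₃ : Submodule 𝒪[E] (Fin 3 → E), IsSelfDualLattice σ ϖ (!![H₂ 0 0, 0, H₂ 0 1; 0, hW, 0; H₂ 1 0, 0, H₂ 1 1] : Matrix (Fin 3) (Fin 3) E) L₃ ∧
            L₃ ⊓ LinearMap.ker ((LinearMap.proj (1 : Fin 3) : (Fin 3 → E) →ₗ[E] E).restrictScalars 𝒪[E]) =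
              B.map ((Matrix.toLin' (!![1, 0; 0, 0; 0, 1] : Matrix (Fin 3) (Fin 2) E)).restrictScalars 𝒪[E]) ∧
            (∀ c : E, (Pi.single 1 c : Fin 3 → E) ∈ L₃ ↔ Valued.v c ≤ Valued.v ϖ ^ b) ∧
            (LatticeNearTransvShell ϖ 1 m ((((endoGL (γ₂, u) : GL (Fin 3) E) : Matrix (Fin 3) (Fin 3) E) - 1)) L₃ ∧ P L₃)} = ∅ := by
  have hvϖ0 : Valued.v ϖ ≠ 0 := by rw [hϖ]; exact exp_ne_zero
  have hϖ0 : ϖ ≠ 0 := fun h0 => hvϖ0 (by rw [h0, map_zero])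
  have hϖlt : Valued.v ϖ < 1 := by rw [hϖ, ← exp_zero, exp_lt_exp]; norm_num
  have hjϖ0 : jE ϖ ≠ 0 := (map_ne_zero jE).2 hϖ0
  have hjϖlt : Valued.v (jE ϖ) < 1 := (v_map_lt_one_iff_of_le_iff jE hjv ϖ).2 hϖlt
  have hcb : Valued.v (jE ϖ ^ j) < Valued.v (jE ϖ) ^ b := by
    rw [Valuation.map_pow]; exact pow_lt_pow_right_of_lt_one₀ (zero_lt_iff.2 ((Valuation.ne_zero_iff _).2 hjϖ0)) hjϖlt hbj
  have hc0 : jE ϖ ^ j ≠ 0 := pow_ne_zero j hjϖ0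
  refine Set.subset_empty_iff.1 fun Λ hΛ => ?_
  obtain ⟨hΛ, B, hBΛ, L₃, hL, hLB, htube, hshell, -⟩ := hΛ
  obtain ⟨x₀, w₀, g₀, hx₀, hΛx, hyO, -, hylev, hw₀Y, hpr, hg₀, hg₀1, hprg⟩ :=
    exists_presentation_of_mem_levelSetDep σ hσ hvσ hϖ hH₂ hH₂σ hhW jE hρρ hvρ hα hα1 hint hΘΘ hΘρ hvΘ hjv hjfix hjpow hϖmax φ hφs hφi hφo hφγ hlam hΘh hh hform
      ((u : Matrix (Fin 1) (Fin 1) E) 0 0) hb1 hlamj hΛ hBΛ hL hLB htube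
  have hY0 : dualGen ρ Θ α (jE ϖ ^ j) h x₀ ≠ 0 := fun h0 => by
    rw [h0, Valuation.map_zero] at hylev
    exact pow_ne_zero b ((Valuation.ne_zero_iff _).2 hjϖ0) hylev.symm
  exact not_latticeNearTransvShell_one_of_antidiagonal hvρ hα hα1 hϖ jE hjv hjfix φ hφs hφi hφγ htube hpr hLB.symm hg₀ hg₀1 hprg hBΛ hc0 hx₀ hΛx hw₀Y hyO hylev hcb
    u hμ hanti m hshell

end Summit.HodgeConjecture.HodgeConjecture.Cruxes.H413.F0P3cDyRamConeCellPresentationLevel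

end
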